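import Literature.Probability.Percolation.CutBlocksFaces
import HarnessLib

/-!
# Counting the landing legs across the upper faces off the bad event

Topic `Probability/Percolation`.  Support file (definitions and proofs, no named fact) for the named
fact `SchrammSmirnov2011_thm_1_7` (the landing count of the proof of Prop. 4.1, Ann. Probab. 39
(2011), §4): an UPWARD LANDING LEG of the collar exploration of `CutBlocks.zones` is a collar site
`y ∈ 𝒪` whose lower neighbour `y - e₁` is a tube site and whose leg `{y, y - e₁}` has a wet face.
The lower neighbour then lies in the top row of a tube block `z` with non-tube upper neighbour, i.e.
`y` sits on the first collar row over the upper face `z` (`exists_upFace_of_leg`); off the total bad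
event `badAll`, its column is more than `w₀` away from the face ends (no corner hub vertex), hence a
landing column of the face (`landingAt_of_leg_up`, via `landingAt_map_of_leg` in a small clean
window), so that the upward landing legs number at most `Σ_{upper faces} faceN`
(`card_legsUp_le`).  The other three directions are symmetric.

## References

* O. Schramm, S. Smirnov, *On the scaling limits of planar percolation*, Ann. Probab. 39 (2011)
  1768–1814, arXiv:1101.5820, §4, proof of Prop. 4.1. [SchrammSmirnov2011]
-/

noncomputable section

open MeasureTheory Set Metric Finset
open Literature.Probability.LatticeModels
open scoped Classical

namespace Literature.Probability.Percolation

namespace CutBlocks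

open Seeded Seeded.CollarDatum

variable {s : ℝ} {α : Set ℂ} {δ : ℝ} {hs : 0 < s} {hδ : 0 < δ} {hα : Bornology.IsBounded α} {𝒵 : Seeded.Zones}

/-- The unit vector `e₁`. [folklore] -/
abbrev e1 : Site 2 := Pi.single 1 1

/-- **Upward landing legs** (by their collar endpoint): `y ∈ K ∩ 𝒪`, `y - e₁ ∈ N`, and the leg
`{y, y - e₁}` has a wet face. [cite: SchrammSmirnov2011, §4, proof of Prop. 4.1 (the legs of the interfaces on β')] -/
def legsUp (𝒵 : Seeded.Zones) (ω : BondConfig (Site 2)) : Finset (Site 2) :=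
  𝒵.K.filter fun y => y - e1 ∈ 𝒵.N ∧
    Seeded.OReach 𝒵.collar.seeds (Seeded.examined 𝒵.collar.seeds ω) ω y ∧
    ∃ f, IsFaceOf f s(y, y - e1) ∧ Seeded.DReach 𝒵.collar.seeds (Seeded.examined 𝒵.collar.seeds ω) ω f

/-- **The face of an upward leg**: the tube site below sits in the top row of an upper face `z`,
the collar site on its first collar row, in the columns of the block. [folklore] -/
theorem exists_upFace_of_leg (h𝒵 : Compat hs hδ hα 𝒵) (hδs : δ ≤ s) {y : Site 2} (hyK : y ∈ 𝒵.K) (hn : y - e1 ∈ 𝒵.N) :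
    ∃ z ∈ upFaces hs hα, y 1 = firstRow s δ z.2 ∧ s * z.1 ≤ δ * y 0 ∧ δ * y 0 ≤ s * (z.1 + 1) := by
  rw [h𝒵.N_eq, mem_zones_N] at hn
  obtain ⟨z, hz, hnb⟩ := hn
  obtain ⟨h1, h2, h3, h4⟩ := hnb
  simp only [meshPoint_re, meshPoint_im, Pi.sub_apply] at h1 h2 h3 h4
  simp at h1 h2 h3 h4
  have hyN : y ∉ Nset s α δ := fun h => h𝒵.not_mem_N_of_mem_K hyK ((mem_zones_N hs hδ hα).2 h)
  -- `y` is not in block `z`: so it is above the top edge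
  have htop : s * (z.2 + 1) < δ * y 1 := by
    by_contra h
    push Not at h
    exact hyN ⟨z, hz, by
      simp only [block, mem_setOf_eq, meshPoint_re, meshPoint_im]
      exact ⟨h1, h2, by linarith, h⟩⟩
  -- the block above is not a tube block
  have hup : (z.1, z.2 + 1) ∉ tubeBlocks s α := fun h =>
    hyN ⟨_, h, by
      simp only [block, mem_setOf_eq, meshPoint_re, meshPoint_im]
      push_cast
      exact ⟨h1, h2, htop.le, by linarith⟩⟩
  refine ⟨z, ?_, ?_, h1, h2⟩
  · rw [upFaces, Finset.mem_filter, mem_tubeFinset]; exact ⟨hz, hup⟩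
  · -- `y 1 - 1 = ⌊s (z₂+1)/δ⌋`
    rw [firstRow]
    have : ⌊s * (z.2 + 1) / δ⌋ = y 1 - 1 := by
      rw [Int.floor_eq_iff, div_lt_iff₀ hδ, le_div_iff₀ hδ]
      push_cast
      constructor <;> linarith
    omega

/-- In the frame of the upper face, the collar site of the leg is `(y 0, 0)` and the tube site `(y 0, -1)`. [folklore] -/
theorem frameUp_leg {y : Site 2} {z : ℤ × ℤ} (hy : y 1 = firstRow s δ z.2) :
    (frameUp s δ z).σ y = ![y 0, 0] ∧ (frameUp s δ z).σ (y - e1) = ![y 0, -1] := by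
  constructor
  · rw [frameUp, downShift_apply]; funext k; fin_cases k <;> simp [hy]
  · rw [frameUp, downShift_apply]; funext k; fin_cases k <;> simp [hy]; ring

/-- The column of a leg lies within one of the face columns. [folklore] -/
theorem faceA_sub_one_le {z : ℤ × ℤ} {x : ℤ} (hδ : 0 < δ) (h1 : s * z.1 ≤ δ * x) (h2 : δ * x ≤ s * (z.1 + 1)) :
    faceA s δ z.1 - 1 ≤ x ∧ x ≤ faceB s δ z.1 + 1 := by
  constructor
  · rw [faceA]
    have : ⌊s * z.1 / δ⌋ ≤ x := Int.floor_le_iff.2 (by rw [div_lt_iff₀ hδ]; nlinarith)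
    omega
  · rw [faceB]
    have : x ≤ ⌈s * (z.1 + 1) / δ⌉ := Int.le_ceil_iff.2 (by rw [lt_div_iff₀ hδ]; nlinarith)
    omega

/-- **Off the bad event an upward leg is a landing column of its face.** [cite: SchrammSmirnov2011, §4, proof of Prop. 4.1] -/
theorem landingAt_of_leg_up (h8 : 8 * δ ≤ s) {w₀ m : ℕ} (hw₀ : 2 ≤ w₀) {ω : BondConfig (Site 2)}
    (h𝒵 : Compat hs hδ hα 𝒵) (hω : ω ∉ badAll hs hα δ 𝒵 w₀ m) {y : Site 2} (hy : y ∈ legsUp 𝒵 ω) {z : ℤ × ℤ} (hz : z ∈ upFaces hs hα)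
    (hy1 : y 1 = firstRow s δ z.2) (hc1 : s * z.1 ≤ δ * y 0) (hc2 : δ * y 0 ≤ s * (z.1 + 1)) :
    faceA s δ z.1 ≤ y 0 ∧ y 0 ≤ faceB s δ z.1 ∧
      (𝒵.collar.map (frameUp s δ z)).LandingAt ((frameUp s δ z).relabel ω) (y 0) := by
  rw [legsUp, Finset.mem_filter] at hy
  obtain ⟨hyK, hnN, hO, f, hf, hD⟩ := hy
  obtain ⟨hσy, hσn⟩ := frameUp_leg (s := s) (δ := δ) hy1
  obtain ⟨hA, hB⟩ := faceA_sub_one_le (s := s) hδ hc1 hc2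
  -- no corner hub vertex: the column is more than `w₀` from the ends
  have hnot : ω ∉ 𝒵.collar.badFace (frameUp s δ z) (faceA s δ z.1) (faceB s δ z.1) w₀ m := by
    intro h
    apply hω
    unfold badAll
    exact Or.inl (Or.inl (Or.inl (Set.mem_biUnion (Finset.mem_coe.2 hz) h)))
  have hO' : Seeded.OReach (𝒵.collar.map (frameUp s δ z)).seeds
      (Seeded.examined (𝒵.collar.map (frameUp s δ z)).seeds ((frameUp s δ z).relabel ω)) ((frameUp s δ z).relabel ω) ![y 0, 0] := by
    rw [map_seeds, ← hσy]
    exact ((frameUp s δ z).oReach_examined_map_iff _ ω y).2 hO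
  have hfarA : w₀ < |y 0 - faceA s δ z.1| := by
    by_contra h
    push Not at h
    exact hnot (Or.inl (Or.inl ⟨y 0, h, hO'⟩))
  have hfarB : w₀ < |y 0 - faceB s δ z.1| := by
    by_contra h
    push Not at h
    exact hnot (Or.inl (Or.inr ⟨y 0, h, hO'⟩))
  have hxA : faceA s δ z.1 + w₀ < y 0 := by
    rw [lt_abs] at hfarA; rcases hfarA with h | h <;> omega
  have hxB : y 0 + w₀ < faceB s δ z.1 := by
    rw [lt_abs] at hfarB; rcases hfarB with h | h <;> omega
  refine ⟨by omega, by omega, ?_⟩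
  -- a small clean window around the column
  have hW : (𝒵.collar.map (frameUp s δ z)).CleanWindow (y 0) 0 0 :=
    h𝒵.cleanWindow (cleanWindow_of_wallFace_fit hs hδ hα h8 (wallFace_of_mem_upFaces hz) (by omega) (by omega))
  exact landingAt_map_of_leg hW (by push_cast; omega) (by push_cast; omega) hσy hσn hO hf hD

/-- The landing columns of a face, as a finite set. [folklore] -/
def landCols (𝒞 : CollarDatum) (ψ : LatticeSym) (a b : ℤ) (ω : BondConfig (Site 2)) : Finset ℤ :=
  (Finset.Icc a b).filter fun x => (𝒞.map ψ).LandingAt (ψ.relabel ω) x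

/-- The landing columns are landings of the face. [folklore] -/
theorem coe_landCols_subset (𝒞 : CollarDatum) (ψ : LatticeSym) (a b : ℤ) (ω : BondConfig (Site 2)) :
    (↑(landCols 𝒞 ψ a b ω) : Set ℤ) ⊆ 𝒞.faceLandings ψ a b ω := by
  intro x hx
  rw [Finset.mem_coe, landCols, Finset.mem_filter, Finset.mem_Icc] at hx
  exact ⟨hx.1.1, hx.1.2, hx.2⟩

/-- **The upward landing legs are few off the bad event.** [cite: SchrammSmirnov2011, §4, proof of Prop. 4.1 (the number of bays is bounded off the small-bay event)] -/
theorem card_legsUp_le (h8 : 8 * δ ≤ s) {w₀ m : ℕ} (hw₀ : 2 ≤ w₀) (hm : 2 ≤ m) {ω : BondConfig (Site 2)}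
    (h𝒵 : Compat hs hδ hα 𝒵) (hω : ω ∉ badAll hs hα δ 𝒵 w₀ m) :
    (legsUp 𝒵 ω).card ≤ ∑ z ∈ upFaces hs hα, faceN (faceA s δ z.1) (faceB s δ z.1) w₀ m := by
  have hδs : δ ≤ s := by linarith
  -- the face of each leg
  have hface : ∀ y ∈ legsUp 𝒵 ω, ∃ z ∈ upFaces hs hα, y 1 = firstRow s δ z.2 ∧ s * z.1 ≤ δ * y 0 ∧ δ * y 0 ≤ s * (z.1 + 1) := by
    intro y hy
    have hy' := hy
    rw [legsUp, Finset.mem_filter] at hy'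
    exact exists_upFace_of_leg h𝒵 hδs hy'.1 hy'.2.1
  choose! zOf hzOf using hface
  -- the target: pairs (face, landing column)
  set T : Finset (Σ _ : ℤ × ℤ, ℤ) := (upFaces hs hα).sigma fun z =>
    landCols 𝒵.collar (frameUp s δ z) (faceA s δ z.1) (faceB s δ z.1) ω with hT
  have hmaps : ∀ y ∈ legsUp 𝒵 ω, (⟨zOf y, y 0⟩ : Σ _ : ℤ × ℤ, ℤ) ∈ T := by
    intro y hy
    obtain ⟨hz, hy1, hc1, hc2⟩ := hzOf y hy
    obtain ⟨hA, hB, hland⟩ := landingAt_of_leg_up h8 hw₀ h𝒵 hω hy hz hy1 hc1 hc2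
    rw [hT, Finset.mem_sigma]
    exact ⟨hz, by rw [landCols, Finset.mem_filter, Finset.mem_Icc]; exact ⟨⟨hA, hB⟩, hland⟩⟩
  have hinj : Set.InjOn (fun y => (⟨zOf y, y 0⟩ : Σ _ : ℤ × ℤ, ℤ)) ↑(legsUp 𝒵 ω) := by
    intro y hy y' hy' h
    simp only [Sigma.mk.injEq, heq_eq_eq] at h
    obtain ⟨hzz, h0⟩ := h
    have h1 : y 1 = y' 1 := by rw [(hzOf y hy).2.1, (hzOf y' hy').2.1, hzz]
    funext k; fin_cases k
    · exact h0
    · exact h1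
  calc (legsUp 𝒵 ω).card ≤ T.card := Finset.card_le_card_of_injOn _ hmaps hinj
    _ = ∑ z ∈ upFaces hs hα, (landCols 𝒵.collar (frameUp s δ z) (faceA s δ z.1) (faceB s δ z.1) ω).card := by
        rw [hT, Finset.card_sigma]
    _ ≤ ∑ z ∈ upFaces hs hα, faceN (faceA s δ z.1) (faceB s δ z.1) w₀ m := by
        refine Finset.sum_le_sum fun z hz => card_landings_le_of_not_bad hm ?_ (coe_landCols_subset _ _ _ _ _)
        intro h
        apply hω
        unfold badAll
        exact Or.inl (Or.inl (Or.inl (Set.mem_biUnion (Finset.mem_coe.2 hz) h)))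

end CutBlocks

end Literature.Probability.Percolation

end
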